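import Literature.Analysis.FluidPDE.SawtoothCascadeRobustCones
import HarnessLib

/-!
# K1loc, line `Spectral` / SeqCone — helper: THE COVECTOR CONE STEP WITH INTEGER-ROUNDED BRANCH SHIFTS, AND THE
# SYMBOL COMPATIBILITY IT YIELDS (T2 design, symbol side)

Helper file of the prover lane on the crux `K1LocalisedCascade` (stmt-AnomalousDissipation-19491), route
`SawtoothPulseCascade`.  The half-slot machinery (`…K1Slot`) tracks symbol energies `Σ μ(k)²|𝓕w|²` and asks, at each
half-slot, for the compatibility `m(A_σ k)² ≤ μ(k)²` of the new symbol `m` with the old one `μ` along EACH branch map of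
the lattice (`…SlotFibreMax`, max-compatibility): for the H half-slot the fibre `k_h` is kept and `k_v ↦ k_v − b` with an
integer shift `|b − σγk_h| ≤ ½`; for the V half-slot `k_v` is kept and `k_h ↦ k_h − b'`, `|b' − σ'γk_v| ≤ ½`
(`σ, σ' = ±1` the strip families).  With `μ = 1 − g`, `m = 1 − g'` (`g, g'` "good-region indicators" with values in
`[0,1]`) the compatibility follows as soon as `g'` EQUALS ONE on the branch image of the support of `g`
(`sq_one_sub_le_of_eq_one_on_supp`).  The content is then the covector cone step of Elgindi–Liss–Mattingly (tree:
`SawtoothCascade.sawtooth_cone_step`, `robust_cone_step`) split into its two half-steps, on the lattice, with the rounding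
of the shifts: the good regions are `S(L, a) = {|k_h| > L, γ|k_v| < a|k_h|}` (unstable cone minus a ball, start of a
phase) and `M(L, a) = {|k_h| > L, ∃σ γ|k_v + σγk_h| < a|k_h|}` (its two H-images, mid-phase);
`coneH_image` : `S(L, a')` is mapped by every H-branch into `M(L, a' + γ/(2L))`;
`coneV_radial` / `coneV_cone` : `M(L, a')` is mapped by every V-branch into `S((γ²−1−a')L − ½, a)` as soon as
`(γ² + a') + a/(2L) ≤ a(γ² − 1 − a')` (the cone condition with the rounding margin);
`compat_H` / `compat_V` : the resulting symbol compatibilities for ANY `[0,1]`-valued `g^S, g^M, g^{S'}` supported in /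
equal to one on these regions (the smooth cone-radial cut-offs of the assembly are one instance).  Per phase the radius
grows by the factor `γ² − 1 − a'` (up to the transition margins), which exceeds the crux's rate `γ² − 3` for apertures
`a' < 2` — the symbol-side form of the cone narrowing `…K1Cone.cone_narrowing_step`.  No definitions; no statement about
the stub.
[cite: ElgindiLissMattingly2025, §1.2.2 (cones C_u, C_s and the cocycle) and §3.1 Lemma 3.1 (cone invariance and
expansion)] [problem: turb]
-/

-- `Summit.<Summit>.<Problem>`: single-conjunct summit, the duplicate namespace segment is deliberate.
set_option linter.dupNamespace false

noncomputable section

namespace Summit.AnomalousDissipation.AnomalousDissipation.Theorems.SawtoothPulseCascade.K1Symbol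

/-! ## From "equal to one on the image of the support" to the squared compatibility -/

/-- **Compatibility from support propagation.**  If `0 ≤ g`, `0 ≤ g' ≤ 1` (at the two points concerned) and
`g > 0 ⇒ g' = 1`, then `(1 − g')² ≤ (1 − g)²` — the form `m² ≤ μ²` (`m = 1 − g'`, `μ = 1 − g`) the un-gauging step asks for.
[folklore] -/
theorem sq_one_sub_le_of_eq_one_on_supp {x y : ℝ} (hx0 : 0 ≤ x) (hy0 : 0 ≤ y) (hy1 : y ≤ 1)
    (h : 0 < x → y = 1) : (1 - y) ^ 2 ≤ (1 - x) ^ 2 := by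
  rcases hx0.eq_or_lt with hx | hx
  · rw [← hx, sub_zero, one_pow]
    nlinarith
  · rw [h hx]
    nlinarith [sq_nonneg (1 - x)]

/-! ## The H half-step: `k_h` kept, `k_v ↦ k_v − b`, `|b − σγk_h| ≤ ½` -/

/-- **H half-step on the lattice.**  If `|k_h| > L > 0`, `γ|k_v| < a'|k_h|` and `|b − σγk_h| ≤ ½`, then the image
`(k_h, k_v − b)` satisfies `γ|(k_v − b) + σγk_h| < (a' + γ/(2L))|k_h|`: the start-of-phase cone is carried into the
sheared mid-phase cone, the rounding of the shift costing the aperture `γ/(2L)`.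
[cite: ElgindiLissMattingly2025, §1.2.2 (the cocycle A(r,s))] -/
theorem coneH_image {γ a' L σ : ℝ} (hγ : 0 ≤ γ) (hL : 0 < L) {kh kv b : ℤ} (hkh : L < |(kh : ℝ)|)
    (hkv : γ * |(kv : ℝ)| < a' * |(kh : ℝ)|) (hb : |(b : ℝ) - σ * γ * kh| ≤ 1 / 2) :
    γ * |((kv - b : ℤ) : ℝ) + σ * γ * kh| < (a' + γ / (2 * L)) * |(kh : ℝ)| := by
  have h1 : |((kv - b : ℤ) : ℝ) + σ * γ * kh| ≤ |(kv : ℝ)| + 1 / 2 := by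
    have e : ((kv - b : ℤ) : ℝ) + σ * γ * kh = (kv : ℝ) - ((b : ℝ) - σ * γ * kh) := by push_cast; ring
    rw [e]
    exact (abs_sub _ _).trans (by linarith)
  have h2 : γ / 2 < γ / (2 * L) * |(kh : ℝ)| ∨ γ = 0 := by
    rcases hγ.eq_or_lt with h0 | hpos
    · exact Or.inr h0.symm
    · left
      rw [div_mul_eq_mul_div, lt_div_iff₀ (by positivity)]
      nlinarith
  rcases h2 with h2 | h0
  · calc γ * |((kv - b : ℤ) : ℝ) + σ * γ * kh| ≤ γ * (|(kv : ℝ)| + 1 / 2) :=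
          mul_le_mul_of_nonneg_left h1 hγ
      _ = γ * |(kv : ℝ)| + γ / 2 := by ring
      _ < a' * |(kh : ℝ)| + γ / (2 * L) * |(kh : ℝ)| := add_lt_add hkv h2
      _ = (a' + γ / (2 * L)) * |(kh : ℝ)| := by ring
  · subst h0
    simp only [zero_mul, zero_div, add_zero] at hkv ⊢
    exact hkv

/-! ## The V half-step: `k_v` kept, `k_h ↦ k_h − b'`, `|b' − σ'γk_v| ≤ ½` -/

/-- **V half-step, radial part.**  If `γ ≥ 1`, `σ, σ' ∈ {±1}`, `γ|k_v + σγk_h| < a'|k_h|` and `|b' − σ'γk_v| ≤ ½`, then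
`|k_h − b'| ≥ (γ² − 1 − a')|k_h| − ½` (`k_h − b' = (1 + σσ'γ²)k_h − σ'γ(k_v + σγk_h) + (σ'γk_v − b')`).
[cite: ElgindiLissMattingly2025, §3.1 Lemma 3.1 (expansion of the first coordinate)] -/
theorem coneV_radial {γ a' σ σ' : ℝ} (hγ : 1 ≤ γ) (hσ : σ = 1 ∨ σ = -1) (hσ' : σ' = 1 ∨ σ' = -1) {kh kv b' : ℤ}
    (hcone : γ * |(kv : ℝ) + σ * γ * kh| < a' * |(kh : ℝ)|) (hb' : |(b' : ℝ) - σ' * γ * kv| ≤ 1 / 2) :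
    (γ ^ 2 - 1 - a') * |(kh : ℝ)| - 1 / 2 ≤ |((kh - b' : ℤ) : ℝ)| := by
  have e : ((kh - b' : ℤ) : ℝ) =
      (1 + σ * σ' * γ ^ 2) * kh - σ' * γ * ((kv : ℝ) + σ * γ * kh) + (σ' * γ * kv - b') := by
    push_cast; ring
  -- `|1 + σσ'γ²| ≥ γ² − 1`
  have hmain : (γ ^ 2 - 1) * |(kh : ℝ)| ≤ |(1 + σ * σ' * γ ^ 2) * (kh : ℝ)| := by
    rw [abs_mul]
    refine mul_le_mul_of_nonneg_right ?_ (abs_nonneg _)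
    have hss : σ * σ' = 1 ∨ σ * σ' = -1 := by
      rcases hσ with h | h <;> rcases hσ' with h' | h' <;> simp [h, h']
    rcases hss with h | h
    · rw [h, one_mul]
      rw [abs_of_nonneg (by positivity)]
      linarith
    · rw [h]
      have hγ2 : (1 : ℝ) ≤ γ ^ 2 := by nlinarith
      rw [show (1 : ℝ) + -1 * γ ^ 2 = -(γ ^ 2 - 1) by ring, abs_neg, abs_of_nonneg (by linarith)]
  have hσ'1 : |σ'| = 1 := by rcases hσ' with h | h <;> simp [h]
  have hmid : |σ' * γ * ((kv : ℝ) + σ * γ * kh)| = γ * |(kv : ℝ) + σ * γ * kh| := by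
    rw [abs_mul, abs_mul, hσ'1, one_mul, abs_of_nonneg (by linarith)]
  have hlast : |σ' * γ * (kv : ℝ) - b'| ≤ 1 / 2 := by rw [abs_sub_comm]; exact hb'
  rw [e]
  have t1 := abs_sub_abs_le_abs_sub ((1 + σ * σ' * γ ^ 2) * (kh : ℝ)) (σ' * γ * ((kv : ℝ) + σ * γ * kh))
  -- `|A − B + C| ≥ |A| − |B| − |C|`
  have t3 : |(1 + σ * σ' * γ ^ 2) * (kh : ℝ)| - |σ' * γ * ((kv : ℝ) + σ * γ * kh)| - |σ' * γ * (kv : ℝ) - b'| ≤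
      |(1 + σ * σ' * γ ^ 2) * (kh : ℝ) - σ' * γ * ((kv : ℝ) + σ * γ * kh) + (σ' * γ * (kv : ℝ) - b')| := by
    have u := abs_sub_abs_le_abs_sub ((1 + σ * σ' * γ ^ 2) * (kh : ℝ) - σ' * γ * ((kv : ℝ) + σ * γ * kh))
      (-(σ' * γ * (kv : ℝ) - b'))
    rw [abs_neg, sub_neg_eq_add] at u
    linarith
  rw [hmid] at t3
  nlinarith [hmain, hlast, t3, hcone, abs_nonneg ((kh : ℝ))]

/-- **V half-step, transverse part.**  If `0 ≤ γ` and `γ|k_v + σγk_h| < a'|k_h|` with `|σ| = 1`, then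
`γ|k_v| ≤ (γ² + a')|k_h|`. [cite: ElgindiLissMattingly2025, §3.1 Lemma 3.1 (the second coordinate)] -/
theorem coneV_transverse {γ a' σ : ℝ} (hγ : 0 ≤ γ) (hσ : σ = 1 ∨ σ = -1) {kh kv : ℤ}
    (hcone : γ * |(kv : ℝ) + σ * γ * kh| < a' * |(kh : ℝ)|) :
    γ * |(kv : ℝ)| ≤ (γ ^ 2 + a') * |(kh : ℝ)| := by
  have hσ1 : |σ| = 1 := by rcases hσ with h | h <;> simp [h]
  have h1 : |(kv : ℝ)| ≤ |(kv : ℝ) + σ * γ * kh| + γ * |(kh : ℝ)| := by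
    have u := abs_sub ((kv : ℝ) + σ * γ * kh) (σ * γ * kh)
    rw [add_sub_cancel_right, abs_mul, abs_mul, hσ1, one_mul, abs_of_nonneg hγ] at u
    exact u
  nlinarith [mul_le_mul_of_nonneg_left h1 hγ, abs_nonneg ((kh : ℝ)), abs_nonneg ((kv : ℝ) + σ * γ * kh)]

/-- **V half-step, the new cone.**  Under the cone condition with rounding margin
`(γ² + a') + a/(2L) ≤ a(γ² − 1 − a')` (`a ≥ 0`, `L > 0`), every `k` of the mid-phase region (`|k_h| > L`,
`γ|k_v + σγk_h| < a'|k_h|`) is mapped by the V-branch (`|b' − σ'γk_v| ≤ ½`) into the start-of-phase cone of aperture `a`: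
`γ|k_v| ≤ a|k_h − b'|`. [cite: ElgindiLissMattingly2025, §3.1 Lemma 3.1 (cone invariance)] -/
theorem coneV_cone {γ a a' L σ σ' : ℝ} (hγ : 1 ≤ γ) (ha : 0 ≤ a) (hL : 0 < L) (hσ : σ = 1 ∨ σ = -1)
    (hσ' : σ' = 1 ∨ σ' = -1) (hca : γ ^ 2 + a' + a / (2 * L) ≤ a * (γ ^ 2 - 1 - a')) {kh kv b' : ℤ}
    (hkh : L < |(kh : ℝ)|) (hcone : γ * |(kv : ℝ) + σ * γ * kh| < a' * |(kh : ℝ)|)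
    (hb' : |(b' : ℝ) - σ' * γ * kv| ≤ 1 / 2) :
    γ * |(kv : ℝ)| ≤ a * |((kh - b' : ℤ) : ℝ)| := by
  have h1 := coneV_radial hγ hσ hσ' hcone hb'
  have h2 := coneV_transverse (by linarith) hσ hcone
  -- `(γ² + a')|k_h| ≤ a((γ²−1−a')|k_h| − ½)` from the cone condition and `|k_h| > L`
  have h3 : (γ ^ 2 + a') * |(kh : ℝ)| ≤ a * ((γ ^ 2 - 1 - a') * |(kh : ℝ)| - 1 / 2) := by
    have hx : 0 < |(kh : ℝ)| := hL.trans hkh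
    have h4 : a / (2 * L) * |(kh : ℝ)| ≥ a / 2 := by
      rw [div_mul_eq_mul_div, ge_iff_le, div_le_div_iff₀ (by norm_num) (by positivity)]
      nlinarith
    nlinarith [mul_le_mul_of_nonneg_right hca hx.le]
  calc γ * |(kv : ℝ)| ≤ (γ ^ 2 + a') * |(kh : ℝ)| := h2
    _ ≤ a * ((γ ^ 2 - 1 - a') * |(kh : ℝ)| - 1 / 2) := h3
    _ ≤ a * |((kh - b' : ℤ) : ℝ)| := mul_le_mul_of_nonneg_left h1 ha

/-- **V half-step, the new radius.**  Under the same hypotheses, `|k_h − b'| ≥ (γ² − 1 − a')L − ½`: per phase the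
radial threshold grows by the factor `γ² − 1 − a'` up to the rounding. [cite: ElgindiLissMattingly2025, §3.1 Lemma 3.1 (expansion)] -/
theorem coneV_radius {γ a' L σ σ' : ℝ} (hγ : 1 ≤ γ) (hσ : σ = 1 ∨ σ = -1) (hσ' : σ' = 1 ∨ σ' = -1)
    (ha' : a' ≤ γ ^ 2 - 1) {kh kv b' : ℤ} (hkh : L < |(kh : ℝ)|)
    (hcone : γ * |(kv : ℝ) + σ * γ * kh| < a' * |(kh : ℝ)|) (hb' : |(b' : ℝ) - σ' * γ * kv| ≤ 1 / 2) :
    (γ ^ 2 - 1 - a') * L - 1 / 2 < |((kh - b' : ℤ) : ℝ)| ∨ (γ ^ 2 - 1 - a' = 0 ∧ -(1 / 2 : ℝ) ≤ |((kh - b' : ℤ) : ℝ)|) := by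
  have h1 := coneV_radial hγ hσ hσ' hcone hb'
  rcases (sub_nonneg.mpr ha').eq_or_lt with h0 | hpos
  · right
    refine ⟨by linarith, ?_⟩
    linarith [abs_nonneg (((kh - b' : ℤ) : ℝ))]
  · left
    have : (γ ^ 2 - 1 - a') * L < (γ ^ 2 - 1 - a') * |(kh : ℝ)| := mul_lt_mul_of_pos_left hkh (by linarith)
    linarith

/-! ## The symbol compatibilities -/

/-- **Compatibility across the H half-slot.**  Let `g^S ≥ 0` and `0 ≤ g^M ≤ 1` on `ℤ × ℤ`, `g^S` be supported in
`S(L, a') = {|k_h| > L, γ|k_v| < a'|k_h|}` and `g^M = 1` on `M(L, a₂) = {|k_h| > L, ∃σ=±1: γ|k_v + σγk_h| ≤ a₂|k_h|}`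
with `a₂ ≥ a' + γ/(2L)`.  Then for every fibre `k_h`, every `k_v`, every family `σ = ±1` and every integer shift with
`|b − σγk_h| ≤ ½`: `(1 − g^M(k_h, k_v − b))² ≤ (1 − g^S(k_h, k_v))²` — the hypothesis `hcomp` of the max-compatibility
un-gauging step for the H half-slot, with `μ = 1 − g^S`, `m = 1 − g^M`.
[cite: ElgindiLissMattingly2025, §1.2.2 (cones and cocycle)] -/
theorem compat_H {γ a' a₂ L : ℝ} (hγ : 0 ≤ γ) (hL : 0 < L) (ha₂ : a' + γ / (2 * L) ≤ a₂)
    {gS gM : ℤ → ℤ → ℝ} (hS0 : ∀ kh kv : ℤ, 0 ≤ gS kh kv)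
    (hM0 : ∀ kh kv : ℤ, 0 ≤ gM kh kv) (hM1 : ∀ kh kv : ℤ, gM kh kv ≤ 1)
    (hS_supp : ∀ kh kv : ℤ, gS kh kv ≠ 0 → L < |(kh : ℝ)| ∧ γ * |(kv : ℝ)| < a' * |(kh : ℝ)|)
    (hM_one : ∀ (kh kv : ℤ) (σ : ℝ), σ = 1 ∨ σ = -1 → L < |(kh : ℝ)| →
      γ * |(kv : ℝ) + σ * γ * kh| ≤ a₂ * |(kh : ℝ)| → gM kh kv = 1)
    (kh kv b : ℤ) {σ : ℝ} (hσ : σ = 1 ∨ σ = -1) (hb : |(b : ℝ) - σ * γ * kh| ≤ 1 / 2) :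
    (1 - gM kh (kv - b)) ^ 2 ≤ (1 - gS kh kv) ^ 2 := by
  refine sq_one_sub_le_of_eq_one_on_supp (hS0 kh kv) (hM0 _ _) (hM1 _ _) fun hpos => ?_
  obtain ⟨hkh, hkv⟩ := hS_supp kh kv hpos.ne'
  have himg := coneH_image (σ := σ) hγ hL hkh hkv hb
  refine hM_one kh (kv - b) σ hσ hkh (himg.le.trans ?_)
  exact mul_le_mul_of_nonneg_right ha₂ (abs_nonneg _)

/-- **Compatibility across the V half-slot.**  Let `g^M ≥ 0` and `0 ≤ g^{S'} ≤ 1` on `ℤ × ℤ`, `g^M` be supported in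
`M(L, a') = {|k_h| > L, ∃σ=±1: γ|k_v + σγk_h| < a'|k_h|}` and `g^{S'} = 1` on
`{|k_h| ≥ L', γ|k_v| ≤ a|k_h|}` with `L' ≤ (γ² − 1 − a')L − ½`, under the cone condition with rounding margin
`(γ² + a') + a/(2L) ≤ a(γ² − 1 − a')` (`γ ≥ 1`, `a ≥ 0`, `a' ≤ γ² − 1`).  Then for every fibre `k_v`, every `k_h`, every
family `σ' = ±1` and every integer shift with `|b' − σ'γk_v| ≤ ½`: `(1 − g^{S'}(k_h − b', k_v))² ≤ (1 − g^M(k_h, k_v))²`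
— the hypothesis `hcomp` for the V half-slot (`μ = 1 − g^M`, `m = 1 − g^{S'}`); the radius grows from `L` to
`(γ² − 1 − a')L − ½`. [cite: ElgindiLissMattingly2025, §3.1 Lemma 3.1 (cone invariance and expansion)] -/
theorem compat_V {γ a a' L L' : ℝ} (hγ : 1 ≤ γ) (ha : 0 ≤ a) (hL : 0 < L) (ha' : a' ≤ γ ^ 2 - 1)
    (hca : γ ^ 2 + a' + a / (2 * L) ≤ a * (γ ^ 2 - 1 - a')) (hL' : L' ≤ (γ ^ 2 - 1 - a') * L - 1 / 2)
    {gM gS' : ℤ → ℤ → ℝ} (hM0 : ∀ kh kv : ℤ, 0 ≤ gM kh kv)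
    (hS0 : ∀ kh kv : ℤ, 0 ≤ gS' kh kv) (hS1 : ∀ kh kv : ℤ, gS' kh kv ≤ 1)
    (hM_supp : ∀ kh kv : ℤ, gM kh kv ≠ 0 → L < |(kh : ℝ)| ∧
      ∃ σ : ℝ, (σ = 1 ∨ σ = -1) ∧ γ * |(kv : ℝ) + σ * γ * kh| < a' * |(kh : ℝ)|)
    (hS_one : ∀ kh kv : ℤ, L' ≤ |(kh : ℝ)| → γ * |(kv : ℝ)| ≤ a * |(kh : ℝ)| → gS' kh kv = 1)
    (kh kv b' : ℤ) {σ' : ℝ} (hσ' : σ' = 1 ∨ σ' = -1) (hb' : |(b' : ℝ) - σ' * γ * kv| ≤ 1 / 2) :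
    (1 - gS' (kh - b') kv) ^ 2 ≤ (1 - gM kh kv) ^ 2 := by
  refine sq_one_sub_le_of_eq_one_on_supp (hM0 kh kv) (hS0 _ _) (hS1 _ _) fun hpos => ?_
  obtain ⟨hkh, σ, hσ, hcone⟩ := hM_supp kh kv hpos.ne'
  have hrad := coneV_radial hγ hσ hσ' hcone hb'
  have hcn := coneV_cone hγ ha hL hσ hσ' hca hkh hcone hb'
  refine hS_one (kh - b') kv (hL'.trans ?_) hcn
  have : (γ ^ 2 - 1 - a') * L ≤ (γ ^ 2 - 1 - a') * |(kh : ℝ)| :=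
    mul_le_mul_of_nonneg_left hkh.le (by linarith)
  linarith

/-- **The cone condition holds on the route's box** with the apertures `a = 13/10`, `a' = 3/2` as soon as `γ ≥ 5` and
`L ≥ 1` (so the pair `(a, a')` closes up under `a ↦ a + ε` margins `ε ≤ 1/5`): `γ² + 3/2 + (13/10)/(2L) ≤ (13/10)(γ² − 5/2)`.
[cite: ElgindiLissMattingly2025, §3.1 Lemma 3.1 (the threshold on α)] -/
theorem cone_condition_box {γ L : ℝ} (hγ : 5 ≤ γ) (hL : 1 ≤ L) :
    γ ^ 2 + 3 / 2 + (13 / 10) / (2 * L) ≤ 13 / 10 * (γ ^ 2 - 1 - 3 / 2) := by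
  have hL0 : 0 < 2 * L := by linarith
  have h1 : (13 / 10) / (2 * L) ≤ 13 / 20 := by
    rw [div_le_iff₀ hL0]; nlinarith
  nlinarith

/-- **The per-phase radial growth beats the crux rate on the box**: with `a' = 3/2` the factor is `γ² − 5/2 > γ² − 3`,
and even after two relative transition margins `ε = 1/250` and the rounding loss at radius `L ≥ 1000`,
`(γ² − 3)·L < ((γ² − 5/2)L − ½)/(1 + 1/250)²` for `5 ≤ γ ≤ 8`. [cite: ElgindiLissMattingly2025, §3.1 Lemma 3.1 (expansion rate)] -/
theorem growth_beats_rate_box {γ L : ℝ} (hγ : 5 ≤ γ) (hγ' : γ ≤ 8) (hL : 1000 ≤ L) :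
    (γ ^ 2 - 3) * L < ((γ ^ 2 - 5 / 2) * L - 1 / 2) / (1 + 1 / 250) ^ 2 := by
  rw [lt_div_iff₀ (by positivity)]
  nlinarith [mul_nonneg (sub_nonneg.mpr hγ') (sub_nonneg.mpr hγ), sq_nonneg γ]

/-! ## The envelope (appended): a sup-norm ball is carried into a larger ball by every branch -/

/-- **Envelope step on the lattice.**  Along either half-slot one coordinate `k_a` is kept and the other is shifted,
`k_c ↦ k_c − b` with `|b − σγk_a| ≤ ½`, `|σ| = 1`.  If `|k_a| < R` and `|k_c| < R` then the image lies in the sup-norm ball of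
radius `R' ≥ (1 + γ)R + ½`: `|k_a| < R'` and `|k_c − b| < R'`.  (Backward compatibility of the envelope symbol
`μ^env = 𝟙{|k|_∞ ≥ R}`: energy cannot jump beyond `(1+γ)R + ½` in one half-slot.)
[cite: ElgindiLissMattingly2025, §1.2.2 (the cocycle A(r,s))] -/
theorem ball_image {γ R R' σ : ℝ} (hγ : 0 ≤ γ) (hσ : σ = 1 ∨ σ = -1) (hR' : (1 + γ) * R + 1 / 2 ≤ R')
    {ka kc b : ℤ} (hka : |(ka : ℝ)| < R) (hkc : |(kc : ℝ)| < R) (hb : |(b : ℝ) - σ * γ * ka| ≤ 1 / 2) :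
    |(ka : ℝ)| < R' ∧ |((kc - b : ℤ) : ℝ)| < R' := by
  have hσ1 : |σ| = 1 := by rcases hσ with h | h <;> simp [h]
  have hR0 : 0 < R := (abs_nonneg _).trans_lt hka
  constructor
  · have : R ≤ (1 + γ) * R + 1 / 2 := by nlinarith
    linarith
  · have e : ((kc - b : ℤ) : ℝ) = (kc : ℝ) - σ * γ * ka - ((b : ℝ) - σ * γ * ka) := by push_cast; ring
    rw [e]
    have h1 := abs_sub ((kc : ℝ) - σ * γ * ka) ((b : ℝ) - σ * γ * ka)
    have h2 := abs_sub (kc : ℝ) (σ * γ * ka)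
    have h3 : |σ * γ * (ka : ℝ)| = γ * |(ka : ℝ)| := by rw [abs_mul, abs_mul, hσ1, one_mul, abs_of_nonneg hγ]
    have h4 : γ * |(ka : ℝ)| ≤ γ * R := mul_le_mul_of_nonneg_left hka.le hγ
    linarith

/-- **Compatibility of the envelope across a half-slot.**  Let `g ≥ 0` be supported in the open sup-norm ball of radius
`R` and `0 ≤ g' ≤ 1` be equal to `1` on the open ball of radius `R' ≥ (1+γ)R + ½` (both as functions of the kept
coordinate `k_a` and the shifted one `k_c`).  Then `(1 − g'(k_a, k_c − b))² ≤ (1 − g(k_a, k_c))²` for every integer shift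
with `|b − σγk_a| ≤ ½` — the hypothesis `hcomp` for the envelope symbols `μ^env = 1 − g` (H half-slot: `a = h`, `c = v`;
V half-slot: `a = v`, `c = h`). [cite: ElgindiLissMattingly2025, §1.2.2 (the cocycle A(r,s))] -/
theorem compat_env {γ R R' : ℝ} (hγ : 0 ≤ γ) (hR' : (1 + γ) * R + 1 / 2 ≤ R')
    {g g' : ℤ → ℤ → ℝ} (hg0 : ∀ ka kc : ℤ, 0 ≤ g ka kc) (hg'0 : ∀ ka kc : ℤ, 0 ≤ g' ka kc)
    (hg'1 : ∀ ka kc : ℤ, g' ka kc ≤ 1)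
    (hg_supp : ∀ ka kc : ℤ, g ka kc ≠ 0 → |(ka : ℝ)| < R ∧ |(kc : ℝ)| < R)
    (hg'_one : ∀ ka kc : ℤ, |(ka : ℝ)| < R' → |(kc : ℝ)| < R' → g' ka kc = 1)
    (ka kc b : ℤ) {σ : ℝ} (hσ : σ = 1 ∨ σ = -1) (hb : |(b : ℝ) - σ * γ * ka| ≤ 1 / 2) :
    (1 - g' ka (kc - b)) ^ 2 ≤ (1 - g ka kc) ^ 2 := by
  refine sq_one_sub_le_of_eq_one_on_supp (hg0 ka kc) (hg'0 _ _) (hg'1 _ _) fun hpos => ?_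
  obtain ⟨hka, hkc⟩ := hg_supp ka kc hpos.ne'
  obtain ⟨h1, h2⟩ := ball_image hγ hσ hR' hka hkc hb
  exact hg'_one ka (kc - b) h1 h2

end Summit.AnomalousDissipation.AnomalousDissipation.Theorems.SawtoothPulseCascade.K1Symbol
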